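import Summits.BirchSwinnertonDyer.BirchSwinnertonDyer.Theses.SignedLowerHalves
import Literature.NumberTheory.EllipticCurves.AnalyticRankModularityProofs
import Literature.NumberTheory.EllipticCurves.ModularParametrizationBCDTProofs
import Literature.NumberTheory.EllipticCurves.SkinnerUrban2014.PAdicUnitPeriodRatioProofs
import HarnessLib

/-!
# Route `SignedLowerHalves`, support item `PublishedSignedInputs` (stmt-BirchSwinnertonDyer-19005):
# the SLIMMED dependency list — the ten-conjunct print pack from its irredundant displayed inputs

D-0154 (2) INPUTS→UNCONDITIONAL, `INPUTS-LIST-2.md` §4 T1 «PackSlim» (cell `pub/bsd-wall`, seat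
`bsd-inputs-pack-p1`). `PublishedSignedInputs` is the conjunction of ten REFEREED named facts
(Wuthrich 2014 Prop. 21, Kobayashi 2003 Thm 1.2 / Thm 4.1, B. D. Kim 2013 Cor 3.15,
Burungale–Kobayashi–Ota 2024 Cor A.5, the two Néron/newform period-unit facts at `p ≥ 5` / `p = 3`,
modularity as parametrisation data, entireness of `L(E,s)`, Gross–Zagier–Kolyvagin), item-stated as
the ten split children 19285, 19286, 19287, 19288, 19289, 19290, 19291, 19266, 19273, 19921. Over the
tree's LANDED theorems three conjuncts are redundant:

* entireness of `L(E,s)` (child `EntireLFunctionRat`, 19273) follows from the parametrisation datum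
  (child `ModularParametrizationSupply`, 19266): the datum gives the newform
  (`ModularForms.exists_isNewformOf_of_nonempty_modularParametrizationData`, BCDT 2001 p. 845 (6) ⇒ (2),
  `ModularParametrizationBCDTProofs.lean`) and the newform gives the entire continuation
  (`WeierstrassCurve.hasEntireLFunction_rat_of_exists_isNewformOf`, `AnalyticRankModularityProofs.lean`);
* both period-unit children (`RealPeriodUnitPlusPeriod` 19290, `RealPeriodUnitPlusPeriodThree` 19291)
  follow from the single printed primary Mazur 1978 Cor. 4.1
  (`ModularForms.mazur_not_dvd_maninConstant_of_odd`, not itself an item of this route) by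
  `SkinnerUrban2014.realPeriodRat_eq_unit_mul_plusPeriod_of_mazur` / `…_three_of_mazur`
  (`SkinnerUrban2014/PAdicUnitPeriodRatioProofs.lean`).

Theorems: `publishedSignedInputs_of_slim_periods` — the pack from NINE of its ten children (all but
`EntireLFunctionRat`), every hypothesis a registered item of this route; `publishedSignedInputs_of_slim`
— the pack from SEVEN children plus Mazur Cor. 4.1 (10 → 8 print inputs). HONEST FRAMING: pure glue
over landed theorems; no cite-only fact is proved here; the remaining inputs stay print hypotheses and
the route stays conditional on them AS TYPED. Nothing here proves BSD; BSD is not proved by any of this.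
-/

set_option autoImplicit false
set_option linter.dupNamespace false

namespace Summit.BirchSwinnertonDyer.BirchSwinnertonDyer.Theorems

open Literature.NumberTheory.EllipticCurves
open Summit.BirchSwinnertonDyer.BirchSwinnertonDyer.Theses.SignedLowerHalves

/-- **`PublishedSignedInputs` from nine of its ten children, BY NAME** (route `SignedLowerHalves`,
item stmt-BirchSwinnertonDyer-19005; INPUTS-LIST-2 T1): the child `EntireLFunctionRat` (19273) is
redundant — the parametrisation datum `ModularParametrizationSupply` (19266) yields the newform
(`ModularForms.exists_isNewformOf_of_nonempty_modularParametrizationData`) and the newform yields the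
entire continuation (`WeierstrassCurve.hasEntireLFunction_rat_of_exists_isNewformOf`). Every
hypothesis is a registered item of the route; pure glue. [folklore] -/
theorem publishedSignedInputs_of_slim_periods
    (hW : WuthrichShaDividesAnalyticSha) (hK12 : KobayashiSignedSelmerTorsion)
    (hK41 : KobayashiSignedKatoDivisibility) (hKim : BDKimSignedCharValueRankZero)
    (hBKO : BKOSignedPPartRankOne) (hPer : RealPeriodUnitPlusPeriod)
    (hPer3 : RealPeriodUnitPlusPeriodThree) (hparam : ModularParametrizationSupply)
    (hGZK : RankEqAnalyticRankLeOne) :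
    Summit.BirchSwinnertonDyer.BirchSwinnertonDyer.Theses.SignedLowerHalves.PublishedSignedInputs :=
  ⟨hW, hK12, hK41, hKim, hBKO, hPer, hPer3, hparam,
    WeierstrassCurve.hasEntireLFunction_rat_of_exists_isNewformOf
      (ModularForms.exists_isNewformOf_of_nonempty_modularParametrizationData hparam),
    hGZK⟩

/-- **`PublishedSignedInputs` from seven children plus Mazur 1978 Cor. 4.1** (10 → 8 print inputs):
as `publishedSignedInputs_of_slim_periods`, with the two period-unit children replaced by their common
printed primary `ModularForms.mazur_not_dvd_maninConstant_of_odd` (the Manin constant is prime to every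
odd `p` with `p² ∤ N`) through the tree theorems
`SkinnerUrban2014.realPeriodRat_eq_unit_mul_plusPeriod_of_mazur` (good `p ≥ 5`) and
`SkinnerUrban2014.realPeriodRat_eq_unit_mul_plusPeriod_three_of_mazur` (good `p = 3`). Pure glue; the
eight hypotheses remain print inputs. [folklore] -/
theorem publishedSignedInputs_of_slim
    (hW : WuthrichShaDividesAnalyticSha) (hK12 : KobayashiSignedSelmerTorsion)
    (hK41 : KobayashiSignedKatoDivisibility) (hKim : BDKimSignedCharValueRankZero)
    (hBKO : BKOSignedPPartRankOne) (hparam : ModularParametrizationSupply)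
    (hGZK : RankEqAnalyticRankLeOne)
    (hMazur : ModularForms.mazur_not_dvd_maninConstant_of_odd) :
    Summit.BirchSwinnertonDyer.BirchSwinnertonDyer.Theses.SignedLowerHalves.PublishedSignedInputs :=
  publishedSignedInputs_of_slim_periods hW hK12 hK41 hKim hBKO
    (SkinnerUrban2014.realPeriodRat_eq_unit_mul_plusPeriod_of_mazur hMazur)
    (SkinnerUrban2014.realPeriodRat_eq_unit_mul_plusPeriod_three_of_mazur hMazur) hparam hGZK

/-- **The dropped child is recovered from the pack's modularity conjunct**: `ModularParametrizationSupply`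
(19266) alone gives `EntireLFunctionRat` (19273) — the in-route edge that makes conjunct 9 redundant.
[folklore] -/
theorem entireLFunctionRat_of_modularParametrizationSupply (hparam : ModularParametrizationSupply) :
    Summit.BirchSwinnertonDyer.BirchSwinnertonDyer.Theses.SignedLowerHalves.EntireLFunctionRat :=
  WeierstrassCurve.hasEntireLFunction_rat_of_exists_isNewformOf
    (ModularForms.exists_isNewformOf_of_nonempty_modularParametrizationData hparam)

end Summit.BirchSwinnertonDyer.BirchSwinnertonDyer.Theorems
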